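import Literature.RepresentationTheory.Ichino2022.FockKTypeCorrespondence
import Literature.Analysis.SegalBargmann.FockDualPairCompact
import Literature.Analysis.SegalBargmann.FockInfinitesimalAction

/-!
# Ichino (2022) §7.5: the Fock model `𝒫`, its `K × K′`-weights, Howe's joint harmonics `ℋ`, "`μ` and `μ′`
# correspond" — as DEFINITIONS; Lemma 7.10 as a named fact OVER THEM

A. Ichino, *Theta lifting for tempered representations of real unitary groups*, Adv. Math. **398** (2022) 108188
= arXiv:2008.06174 [Ichino2022ThetaReal], §7.5 (held text `paper:arxiv-2008.06174`, chunks p0019–p0020 = the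
arXiv LaTeX source; chunk indices, not folios).  The companion file
`Literature.RepresentationTheory.Ichino2022.FockKTypeCorrespondence` types §4.1 (`SplittingDatum`), the parameters
and the two displayed weights of Lemma 7.10 (`HarmonicParam`, `.mu`, `.mu'`) as REAL definitions, but the relation
"`μ` and `μ′` correspond" only as a DICTIONARY (`FockHarmonics S` = a free relation `corresponds`, with
`FockHarmonics.Lemma_7_10` a predicate on it).  This file retires the free carrier: it DEFINES Ichino's standing
set-up of §7.5 — the polynomial Fock model, its grading, the weights and raising operators of `𝔨 × 𝔨′`, Howe's
harmonics and joint harmonics, occurrence of a `K × K′`-type in `ℋ`, the `(r,s)`-degree — builds the CANONICAL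
dictionary `fockHarmonics S : FockHarmonics S` from them, and states Lemma 7.10 over it as ONE named fact
`Ichino2022_Lemma_7_10` (a CITE record; its proof — a highest-weight computation in classical invariant theory,
Kashiwara–Vergne / Howe / Konno–Konno — is not reproduced here).

## The printed set-up (verbatim)

§7.5 [corpus:paper:arxiv-2008.06174 p0019 L128–L140]: "To prove Lemma 7.9, we need the notion of `K`-types of
minimal degrees introduced by Howe [howe2].  Let `(p,q)` be the signature of `W`.  We take the maximal compact
subgroup `K ≅ U(p) × U(q)` of `U(W) = U(p,q)` as in §3.1 and parametrize the irreducible representations of `K` by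
highest weights `(a₁, …, a_p; b₁, …, b_q)`, where `a_i, b_j ∈ ℤ`; `a₁ ≥ ⋯ ≥ a_p` and `b₁ ≥ ⋯ ≥ b_q`.  Similarly, we
take the maximal compact subgroup `K′ ≅ U(r) × U(s)` of `U(V) = U(r,s)` and parametrize the irreducible
representations of `K′`."  [p0020 L1–L7]: "Let `𝒫 = ⊕_{d=0}^∞ 𝒫_d` be the Fock model of the Weil representation
`ω_{V,W,χ_V,χ_W,ψ}` of `U(W) × U(V)` relative to the datum `(χ_V,χ_W,ψ)` given in §4.1, where `𝒫` is the space of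
polynomials in `mn` variables and `𝒫_d` is the subspace of homogeneous polynomials of degree `d`.  Note that `𝒫_d`
is invariant under the action of `K × K′`.  For any irreducible representation `μ` of `K` occurring in `𝒫`, we
define the `(r,s)`-degree of `μ` as the smallest nonnegative integer `d` such that the `μ`-isotypic component of
`𝒫_d` is nonzero, which depends only on `r−s` (see [paul1]).  Let `ℋ` be the space of joint harmonics, which is a
`K × K′`-invariant subspace of `𝒫`.  For any irreducible representations `μ` and `μ′` of `K` and `K′`,
respectively, we say that `μ` and `μ′` correspond if `μ ⊠ μ′` occurs in `ℋ`, in which case `μ` and `μ′` determine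
each other.  This correspondence can be described as follows."  **Lemma 7.10** [p0020 L9–L24] is quoted verbatim in
the companion file (`FockHarmonics.Lemma_7_10`); its proof there [p0020 L26–L29]: "Given our choice of the datum
`(χ_V, χ_W, ψ)`, the assertion follows from [konno].  We remark that the convention in [konno] is different from
ours (see [konno] and [gi2]).  In particular, to switch the left and right actions of `U(W)` on `W`, we need to
compose the Weil representation `ω_{V,W,ξ}` as in [konno] relative to the pair `ξ = (χ_W, χ_V^{-1})` with the
automorphism `g ↦ ᵗg^{-1}` of `U(p,q)`."  [p0020 L36–L38]: "Let `μ` be a `K`-type of `π` … We say that `μ` is of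
minimal `(r,s)`-degree in `π` if the `(r,s)`-degree of `μ` is minimal among all `K`-types of `π`, in which case `μ`
occurs in `ℋ`."

The harmonics are Howe's [Howe1989, §3 (3.6) p. 541; corpus:paper:doi-10-1090-s0894-0347-1989-0985172-6 p0007
L29]: "`ℋ(L) = {P ∈ 𝒫 : l′(P) = 0 for all l′ ∈ 𝔩′^{(0,2)}}`" for a compact `L ⊆ U` with centraliser `L′`
("`𝔩′ = 𝔩′^{(1,1)} ⊕ 𝔩′^{(2,0)} ⊕ 𝔩′^{(0,2)}`"), applied [p. 542, p0008 L22–L25] with "`L` be `K` or `K′` … Then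
`L′` will be `M′` or `M`, respectively" (`M′ ⊇ G′` the centraliser of `K` in `Sp`), the joint harmonics being
`ℋ(K) ∩ ℋ(K′)` [Prop. 3.4 p. 544, p0010 L37: "The space `ℋ(K) ∩ ℋ(K′)` generates `𝒫` as a `𝔤 × 𝔤′` module";
p0010 L50: "the constants are both `K` and `K′` harmonic"; §7 (b) pp. 551–552, p0017 L66–L69: "a bijection
`σ ↔ σ′` between certain subsets of `𝓡(K, ω)` and `𝓡(K′, ω)`, defined by the action of `K·K′` on the joint
harmonics `ℋ(K) ∩ ℋ(K′)`"].  For the unitary dual pair they are made explicit by Ichino's source [KonnoKonno2007,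
§5.1 pp. 70–71; corpus:paper:doi-10-2206-kyushujm-61-35 p0036 L105–p0037 L12]: "By definition, the spaces of `K_W`
and `K_V`-harmonics are given by `ℋ_V(K_W) := {P ∈ P_{V,W,ξ} | ω_{W±,ξ±}(𝔭⁻_{V,W±}) P = 0}`,
`ℋ_W(K_V) := {P ∈ P_{V,W,ξ} | ω_{V±,ξ′±}(𝔭⁻_{W,V±}) P = 0}`, respectively.  Their intersection
`J_{V,W,ξ} := ℋ_V(K_W) ∩ ℋ_W(K_V)` is called the space of joint harmonics. … `J_{V,W,ξ}` consists of
`P ∈ P_{V,W,ξ}` killed by `Σ_{ℓ=1}^{p′} ∂²/∂w_{j,ℓ}∂w_{p+k,ℓ}`, `Σ_{ℓ=p′+1}^{n′} ∂²/∂w_{j,ℓ}∂w_{p+k,ℓ}`,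
`Σ_{ℓ=1}^{p} ∂²/∂w_{ℓ,j}∂w_{ℓ,p′+k}`, `Σ_{ℓ=p+1}^{n} ∂²/∂w_{ℓ,j}∂w_{ℓ,p′+k}`" — the variables `w_{j,k}` being an
(index of `V`) × (index of `W`) array, the four families contracting a same-sign pair-block against a mixed one over
the index of ONE of the four compact factors (in [KonnoKonno2007] `V` is hermitian of signature `(p,q)` and `W`
skew-hermitian of signature `(p′,q′)`; Ichino's letters are `V ↔ (r,s)`, `W ↔ (p,q)`).

## What is DEFINED here (Ichino's letters: `K = U(p) × U(q)` for `W`, `K′ = U(r) × U(s)` for `V`)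

* `Idx S` — the `mn = (r+s)(p+q)` variables (`card_Idx`), as the tree's block index type
  `Literature.Analysis.SegalBargmann.DPIdx (Fin r) (Fin s) (Fin p) (Fin q)`: the two same-sign pair-blocks
  `V⁺⊗W⁺` (`zPR a i`), `V⁻⊗W⁻` (`zQS b j`) and the two mixed ones `V⁺⊗W⁻` (`zPS a j`), `V⁻⊗W⁺` (`zQR b i`);
  `Fock S = ℂ[z_l : l ∈ Idx S]` (`𝒫`), `fockDeg S d` (`𝒫_d`, Mathlib's `homogeneousSubmodule`).
* The WEIGHTS of `𝔨 × 𝔨′` on monomials: the four sign functions `sgnK₁ i, sgnK₂ j, sgnK'₁ a, sgnK'₂ b : Idx S → ℤ`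
  (`+1` for a variable of a same-sign block carrying the index, `−1` for a mixed-block variable carrying it — the
  signs of the tree's torus datum `dualPairι`/`torusChar_dpTorus` in `FockDualPairCompact`, i.e. the realisation
  in which the same-sign blocks have POSITIVE degree weights, which is Ichino's normalisation
  `ψ_∞(x) = e^{−2π√−1 x}` and that of the explicit models `Ichino2022/ExplicitLineModel` (`uW`, `rowW`, `wDeg`)),
  `IsWeightVector S F n n′` (Mathlib `IsWeightedHomogeneous` for all `p+q+r+s` coordinates), and the printed
  scalar normalisation as the shift maps `shiftK S n = n + ((r−s)/2, …; (s−r)/2, …) + (m₀/2, …)`,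
  `shiftK' S n′ = n′ + ((p−q)/2, …; (q−p)/2, …) + (n₀/2, …)` from integral polynomial weights to the printed
  highest weights (the constants of `𝒫` get the weight of Lemma 7.10 with all four strings empty).
* The RAISING operators of `𝔨_ℂ × 𝔨′_ℂ = 𝔤𝔩_p ⊕ 𝔤𝔩_q ⊕ 𝔤𝔩_r ⊕ 𝔤𝔩_s` for the upper-triangular Borels (the
  dominance order `a₁ ≥ ⋯ ≥ a_p` of the printed parametrisation): `raiseK₁ i i′ = Σ_a z_{ai} ∂_{ai′} − Σ_b
  z_{bi′} ∂_{bi}` (covariant on the same-sign block, contragredient on the mixed block; likewise `raiseK₂`,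
  `raiseK'₁`, `raiseK'₂`), built from the tree's `mulXPDeriv k j = z_k ∂_j`; `IsHighest S F` (killed by all of
  them with `i < i′`).
* Howe's HARMONIC operators, the four printed families: `lapK₁ a b = Σ_i ∂_{z_{ai}} ∂_{z_{bi}}` (over the `U(p)`
  index), `lapK₂ a b = Σ_j ∂_{z_{aj}} ∂_{z_{bj}}` (over `U(q)`), `lapK'₁ i j = Σ_a ∂∂` (over `U(r)`), `lapK'₂ i j =
  Σ_b ∂∂` (over `U(s)`); `harmonicsK S = ℋ(K)` (killed by the `K`-invariant ones `lapK₁, lapK₂`), `harmonicsK' S =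
  ℋ(K′)`, `jointHarmonics S = ℋ(K) ∩ ℋ(K′) = ℋ`.
* `IsJointHWVector S F n n′` (non-zero, in `ℋ`, weight vector, highest), `IWt.IsDominant`, and
  **`corresponds S μ μ′`** — "`μ ⊠ μ′` occurs in `ℋ`": `ℋ` contains a joint highest-weight vector whose shifted
  weights are the dominant pair `(μ, μ′)`; the canonical dictionary **`fockHarmonics S : FockHarmonics S`**; the
  `K`-side notions `IsKHWVector`, `KTypeOccursIn U μ`, the `(r,s)`-degree `kTypeDegree S μ ∈ ℕ∞` (`⊤` if `μ` does
  not occur in `𝒫`), `OccursInHarmonics`, and `IsOfMinimalDegreeIn T μ` for a set `T` of `K`-types (of some `π`) —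
  the vocabulary of Lemma 7.11.
* **`Ichino2022_Lemma_7_10 : Prop := ∀ S, (fockHarmonics S).Lemma_7_10`** — the ONE named fact of this file (net
  debt +1; CITE record [cite: Ichino2022ThetaReal, §7.5 Lemma 7.10]); nothing else is asserted.

## What is PROVED here (sanity of the conventions against the printed lemma; `0` facts used)

* `C_mem_jointHarmonics`, `X_mem_jointHarmonics` — constants and linear polynomials are joint harmonic (Howe p. 544:
  "the constants are both `K` and `K′` harmonic");
* `corresponds_vacuum` — the constants realise the parameter of Lemma 7.10 with all strings empty
  (`HarmonicParam.vacuum`): `(fockHarmonics S).corresponds μ_vac μ′_vac` UNCONDITIONALLY (the dictionary file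
  derives the same pair from the hypothesis `Lemma_7_10`);
* `corresponds_posBox` — for `p, r ≥ 1` the variable `z_{a₁ i₁}` of the block `V⁺⊗W⁺` (first indices) is a joint
  harmonic highest-weight vector realising the parameter `p⁺ = 1, a = (1)` (the pair `μ = (1,0,…;0,…) + shifts`,
  `μ′ = (1,0,…;0,…) + shifts′`);
* `corresponds_negBox` — for `p, s ≥ 1` the variable `z_{b_s i_p}` of the mixed block `V⁻⊗W⁺` (LAST indices) realises
  `p⁻ = 1, b = (−1)` (`μ = (0,…,0,−1;0,…) + shifts`, `μ′ = (0,…;0,…,0,−1) + shifts′`).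
These are three instances of the "if" direction of the printed lemma and pin the orientation conventions (which
block is covariant for which factor, first-vs-last index, the scalar shifts) against its displayed shape.

## Junk / scope analysis

* MODEL, NOT THE ANALYTIC `ω`.  `Fock S` with the operators above is the polynomial (`𝔨 × 𝔨′`, Howe-Laplacian)
  module that print calls "the Fock model of `ω_{V,W,χ_V,χ_W,ψ}`"; the identification of its elements with the
  `K × K′`-finite vectors of an analytic realisation of the Weil representation (Bargmann transform; tree
  `Literature/Analysis/SegalBargmann/FockKFinite`, `FockPolynomialWeights`: "the polynomial weights of the explicit
  models ARE the torus weights of the constructed realisation, up to the vacuum character") and the value of that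
  vacuum character (Ichino's shifts = [KonnoKonno2007] Lemma 5.2 / Thm 5.4 (i), tree record
  `KonnoKonno2007.RealDualPairJunction.FockVacuumCharacter`) are NOT asserted here: the shifts are DEFINED to be the
  printed ones.  So `Ichino2022_Lemma_7_10` asserts exactly the invariant-theoretic content of the lemma: the joint
  harmonic highest weights of `ℂ[M_{(r+s)×(p+q)}]` are the displayed ones.
* CONVENTIONS are forced by the displayed shape: the `a`-string is shared by the heads of `μ.1` and `μ′.1` (so
  `V⁺⊗W⁺` is covariant for `U(p)` and `U(r)`), the `c`-string by the heads of `μ.2`, `μ′.2` (`V⁻⊗W⁻` covariant for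
  `U(q)`, `U(s)`), the negative `b`-string sits at the TAILS of `μ.1` and `μ′.2` (`V⁻⊗W⁺` contragredient for `U(p)`,
  `U(s)`), the `d`-string at the tails of `μ.2`, `μ′.1`; the relative sign inside each raising operator is the one
  killing the invariant pairings `Σ_i z_{ai} z_{bi}`.  At `(p,q;r,s) = (1,0;2,1)` the definitions specialise
  literally (under `Idx S ≃ Fin 2 ⊕ Unit`) to binder-1's explicit model `ExplicitLineModel` (`ℋ = ker ∂_{z_a}∂_w`,
  `E₊ = z₁∂_{z₂}`, weights `uW, rowW, −wDeg`), where Lemma 7.10 is PROVED (`ExplicitLine.lemma_7_10_explicitLine`).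
* NON-DOMINANT ARGUMENTS.  `FockHarmonics.corresponds` ranges over all rational vectors; `corresponds S μ μ′`
  contains dominance and integrality-up-to-shift of `(μ, μ′)` (they name irreducible representations of `K`, `K′`),
  so for any other argument both sides of `Lemma_7_10` are false by definition / by the shape of `HarmonicParam.mu`.
  "Occurs" is rendered by highest-weight vectors: for the locally finite `K × K′`-module `𝒫` (each `𝒫_d` is
  finite-dimensional and `K × K′`-stable) an irreducible `μ ⊠ μ′` occurs in the invariant subspace `ℋ` iff `ℋ`
  contains a non-zero vector of weight `(μ, μ′)` killed by `𝔫⁺ × 𝔫′⁺` (complete reducibility and uniqueness of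
  the highest weight line) — this standard equivalence is the only reading step.
* Lemmas 7.9 and 7.11 of §7.5 (non-vanishing of `Θ(π)` for discrete series `π` with `(r,s) = (r_π + l, s_π + l)`,
  `l ≥ k_π/2` [p0019 L115–L124]; "the lowest `K`-type of `π` is of minimal `(r,s)`-degree in `π`" [p0020 L40–L52])
  are NOT typed: their hypotheses live in the §6–§7.4 vocabulary (`k_π, r_π, s_π` from Harish-Chandra parameters,
  `θ_{V,W,…}(π) ≠ 0`, lowest `K`-types) which the tree does not have, and no consumer reads them (the stage-1
  binder `occ` (C7) is produced from explicit kernel models, cell pub-hodgecm BY-NAME list 2026-08-18T20:29:05Z);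
  `kTypeDegree` / `IsOfMinimalDegreeIn` / `OccursInHarmonics` are the definitional hooks for 7.11's conclusion.

## References

* [Ichino2022ThetaReal] A. Ichino, Adv. Math. 398 (2022) 108188 = arXiv:2008.06174, §4.1, §7.5 (Lemmas 7.9–7.11).
* [Howe1989] R. Howe, Transcending classical invariant theory, J. Amer. Math. Soc. 2 (1989) 535–552, §3 (3.6),
  Prop. 3.4, §7 (b).
* [KonnoKonno2007] T. Konno, K. Konno, Kyushu J. Math. 61 (2007) 35–82, §5.1, Lemma 5.2, Thm 5.4.
* [Adams2007Theta] J. Adams, The theta correspondence over ℝ (2007), §6 Def 6.1/6.2 (compact case; tree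
  `Literature.RepresentationTheory.Adams2007.CompactDualPairs`).
-/

noncomputable section

namespace Literature.RepresentationTheory.Ichino2022

open MvPolynomial
open Literature.Analysis.SegalBargmann (DPIdx pderivLin pderivLin_apply mulXPDeriv mulXPDeriv_apply)

variable (S : SplittingDatum)

/-! ## 1. The Fock model `𝒫`: polynomials in `mn` variables, graded by degree -/

/-- **The index of the `mn` variables of `𝒫`** (`m = r + s`, `n = p + q`): the tree's block index type of
`𝕎 = V ⊗ W` for `V` of signature `(r,s)` and `W` of signature `(p,q)` — blocks `V⁺⊗W⁺`, `V⁻⊗W⁻` (same sign), then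
`V⁺⊗W⁻`, `V⁻⊗W⁺` (mixed). [cite: Ichino2022ThetaReal, §7.5] -/
abbrev Idx : Type := DPIdx (Fin S.r) (Fin S.s) (Fin S.p) (Fin S.q)

/-- **`𝒫`, the Fock model as a polynomial ring** `ℂ[z_l : l ∈ Idx S]` in `mn` variables.
[cite: Ichino2022ThetaReal, §7.5] -/
abbrev Fock : Type := MvPolynomial (Idx S) ℂ

/-- "`𝒫` is the space of polynomials in `mn` variables": `|Idx S| = (r+s)(p+q) = mn`.
[cite: Ichino2022ThetaReal, §7.5] -/
theorem card_Idx : Fintype.card (Idx S) = (S.r + S.s) * (S.p + S.q) := by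
  simp only [Idx, DPIdx, Fintype.card_sum, Fintype.card_prod, Fintype.card_fin]
  ring

/-- **`𝒫_d`**, the homogeneous polynomials of degree `d`. [cite: Ichino2022ThetaReal, §7.5] -/
def fockDeg (d : ℕ) : Submodule ℂ (Fock S) := homogeneousSubmodule (Idx S) ℂ d

/-- Unfolding: `F ∈ 𝒫_d ↔ F` is homogeneous of degree `d`. [cite: Ichino2022ThetaReal, §7.5] -/
theorem mem_fockDeg {d : ℕ} {F : Fock S} : F ∈ fockDeg S d ↔ F.IsHomogeneous d :=
  mem_homogeneousSubmodule d F

/-- The variable `z_{a i}` of the same-sign block `V⁺ ⊗ W⁺` (`a` a `U(r)`-index, `i` a `U(p)`-index). [cite: Ichino2022ThetaReal, §7.5] -/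
abbrev zPR (a : Fin S.r) (i : Fin S.p) : Idx S := Sum.inl (Sum.inl (a, i))
/-- The variable `z_{b j}` of the same-sign block `V⁻ ⊗ W⁻` (`b` a `U(s)`-index, `j` a `U(q)`-index). [cite: Ichino2022ThetaReal, §7.5] -/
abbrev zQS (b : Fin S.s) (j : Fin S.q) : Idx S := Sum.inl (Sum.inr (b, j))
/-- The variable `z_{a j}` of the mixed block `V⁺ ⊗ W⁻`. [cite: Ichino2022ThetaReal, §7.5] -/
abbrev zPS (a : Fin S.r) (j : Fin S.q) : Idx S := Sum.inr (Sum.inl (a, j))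
/-- The variable `z_{b i}` of the mixed block `V⁻ ⊗ W⁺`. [cite: Ichino2022ThetaReal, §7.5] -/
abbrev zQR (b : Fin S.s) (i : Fin S.p) : Idx S := Sum.inr (Sum.inr (b, i))

/-! ## 2. The weights of `𝔨 × 𝔨′` on monomials and the printed scalar shifts -/

/-- Sign of the `i`-th coordinate of `U(p)` on the variables: `+1` on `z_{a i}` (`V⁺⊗W⁺`), `−1` on `z_{b i}`
(`V⁻⊗W⁺`), `0` elsewhere; the `U(p)`-weight of `z^m` is `Σ_l sgnK₁ i l · m l` (plus the shift).
[cite: Ichino2022ThetaReal, §7.5 Lemma 7.10] -/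
def sgnK₁ (i : Fin S.p) : Idx S → ℤ
  | Sum.inl (Sum.inl ai) => if ai.2 = i then 1 else 0
  | Sum.inl (Sum.inr _) => 0
  | Sum.inr (Sum.inl _) => 0
  | Sum.inr (Sum.inr bi) => if bi.2 = i then -1 else 0

/-- Sign of the `j`-th coordinate of `U(q)`: `+1` on `z_{b j}` (`V⁻⊗W⁻`), `−1` on `z_{a j}` (`V⁺⊗W⁻`).
[cite: Ichino2022ThetaReal, §7.5 Lemma 7.10] -/
def sgnK₂ (j : Fin S.q) : Idx S → ℤ
  | Sum.inl (Sum.inl _) => 0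
  | Sum.inl (Sum.inr bj) => if bj.2 = j then 1 else 0
  | Sum.inr (Sum.inl aj) => if aj.2 = j then -1 else 0
  | Sum.inr (Sum.inr _) => 0

/-- Sign of the `a`-th coordinate of `U(r)`: `+1` on `z_{a i}` (`V⁺⊗W⁺`), `−1` on `z_{a j}` (`V⁺⊗W⁻`).
[cite: Ichino2022ThetaReal, §7.5 Lemma 7.10] -/
def sgnK'₁ (a : Fin S.r) : Idx S → ℤ
  | Sum.inl (Sum.inl ai) => if ai.1 = a then 1 else 0
  | Sum.inl (Sum.inr _) => 0
  | Sum.inr (Sum.inl aj) => if aj.1 = a then -1 else 0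
  | Sum.inr (Sum.inr _) => 0

/-- Sign of the `b`-th coordinate of `U(s)`: `+1` on `z_{b j}` (`V⁻⊗W⁻`), `−1` on `z_{b i}` (`V⁻⊗W⁺`).
[cite: Ichino2022ThetaReal, §7.5 Lemma 7.10] -/
def sgnK'₂ (b : Fin S.s) : Idx S → ℤ
  | Sum.inl (Sum.inl _) => 0
  | Sum.inl (Sum.inr bj) => if bj.1 = b then 1 else 0
  | Sum.inr (Sum.inl _) => 0
  | Sum.inr (Sum.inr bi) => if bi.1 = b then -1 else 0

section SignValues

variable {S}

/-- [cite: Ichino2022ThetaReal, §7.5 Lemma 7.10] -/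
@[simp] theorem sgnK₁_zPR (i : Fin S.p) (a : Fin S.r) (i' : Fin S.p) :
    sgnK₁ S i (zPR S a i') = if i' = i then 1 else 0 := rfl
/-- [cite: Ichino2022ThetaReal, §7.5 Lemma 7.10] -/
@[simp] theorem sgnK₁_zQS (i : Fin S.p) (b : Fin S.s) (j : Fin S.q) : sgnK₁ S i (zQS S b j) = 0 := rfl
/-- [cite: Ichino2022ThetaReal, §7.5 Lemma 7.10] -/
@[simp] theorem sgnK₁_zPS (i : Fin S.p) (a : Fin S.r) (j : Fin S.q) : sgnK₁ S i (zPS S a j) = 0 := rfl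
/-- [cite: Ichino2022ThetaReal, §7.5 Lemma 7.10] -/
@[simp] theorem sgnK₁_zQR (i : Fin S.p) (b : Fin S.s) (i' : Fin S.p) :
    sgnK₁ S i (zQR S b i') = if i' = i then -1 else 0 := rfl
/-- [cite: Ichino2022ThetaReal, §7.5 Lemma 7.10] -/
@[simp] theorem sgnK₂_zPR (j : Fin S.q) (a : Fin S.r) (i : Fin S.p) : sgnK₂ S j (zPR S a i) = 0 := rfl
/-- [cite: Ichino2022ThetaReal, §7.5 Lemma 7.10] -/
@[simp] theorem sgnK₂_zQS (j : Fin S.q) (b : Fin S.s) (j' : Fin S.q) :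
    sgnK₂ S j (zQS S b j') = if j' = j then 1 else 0 := rfl
/-- [cite: Ichino2022ThetaReal, §7.5 Lemma 7.10] -/
@[simp] theorem sgnK₂_zPS (j : Fin S.q) (a : Fin S.r) (j' : Fin S.q) :
    sgnK₂ S j (zPS S a j') = if j' = j then -1 else 0 := rfl
/-- [cite: Ichino2022ThetaReal, §7.5 Lemma 7.10] -/
@[simp] theorem sgnK₂_zQR (j : Fin S.q) (b : Fin S.s) (i : Fin S.p) : sgnK₂ S j (zQR S b i) = 0 := rfl
/-- [cite: Ichino2022ThetaReal, §7.5 Lemma 7.10] -/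
@[simp] theorem sgnK'₁_zPR (a : Fin S.r) (a' : Fin S.r) (i : Fin S.p) :
    sgnK'₁ S a (zPR S a' i) = if a' = a then 1 else 0 := rfl
/-- [cite: Ichino2022ThetaReal, §7.5 Lemma 7.10] -/
@[simp] theorem sgnK'₁_zQS (a : Fin S.r) (b : Fin S.s) (j : Fin S.q) : sgnK'₁ S a (zQS S b j) = 0 := rfl
/-- [cite: Ichino2022ThetaReal, §7.5 Lemma 7.10] -/
@[simp] theorem sgnK'₁_zPS (a : Fin S.r) (a' : Fin S.r) (j : Fin S.q) :
    sgnK'₁ S a (zPS S a' j) = if a' = a then -1 else 0 := rfl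
/-- [cite: Ichino2022ThetaReal, §7.5 Lemma 7.10] -/
@[simp] theorem sgnK'₁_zQR (a : Fin S.r) (b : Fin S.s) (i : Fin S.p) : sgnK'₁ S a (zQR S b i) = 0 := rfl
/-- [cite: Ichino2022ThetaReal, §7.5 Lemma 7.10] -/
@[simp] theorem sgnK'₂_zPR (b : Fin S.s) (a : Fin S.r) (i : Fin S.p) : sgnK'₂ S b (zPR S a i) = 0 := rfl
/-- [cite: Ichino2022ThetaReal, §7.5 Lemma 7.10] -/
@[simp] theorem sgnK'₂_zQS (b : Fin S.s) (b' : Fin S.s) (j : Fin S.q) :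
    sgnK'₂ S b (zQS S b' j) = if b' = b then 1 else 0 := rfl
/-- [cite: Ichino2022ThetaReal, §7.5 Lemma 7.10] -/
@[simp] theorem sgnK'₂_zPS (b : Fin S.s) (a : Fin S.r) (j : Fin S.q) : sgnK'₂ S b (zPS S a j) = 0 := rfl
/-- [cite: Ichino2022ThetaReal, §7.5 Lemma 7.10] -/
@[simp] theorem sgnK'₂_zQR (b : Fin S.s) (b' : Fin S.s) (i : Fin S.p) :
    sgnK'₂ S b (zQR S b' i) = if b' = b then -1 else 0 := rfl

end SignValues

/-- Integral weight vectors `(n₁, …, n_k; n′₁, …, n′_l)` of `U(k) × U(l)` (the polynomial weights, before the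
half-integral shifts). [cite: Ichino2022ThetaReal, §7.5] -/
abbrev IWt (k l : ℕ) : Type := (Fin k → ℤ) × (Fin l → ℤ)

/-- **Dominance** `n₁ ≥ ⋯ ≥ n_k`, `n′₁ ≥ ⋯ ≥ n′_l`: the integral weight is the highest weight of an irreducible
representation of `U(k) × U(l)` ("`a₁ ≥ ⋯ ≥ a_p` and `b₁ ≥ ⋯ ≥ b_q`"). [cite: Ichino2022ThetaReal, §7.5] -/
def IWt.IsDominant {k l : ℕ} (n : IWt k l) : Prop := Antitone n.1 ∧ Antitone n.2

/-- **`F` is a weight vector of `𝔨 × 𝔨′` with polynomial weights `(n; n′)`**: weighted-homogeneous for every one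
of the `p + q + r + s` coordinate sign functions. [cite: Ichino2022ThetaReal, §7.5] -/
structure IsWeightVector (F : Fock S) (n : IWt S.p S.q) (n' : IWt S.r S.s) : Prop where
  /-- `U(p)`-weights -/
  K₁ : ∀ i, IsWeightedHomogeneous (sgnK₁ S i) F (n.1 i)
  /-- `U(q)`-weights -/
  K₂ : ∀ j, IsWeightedHomogeneous (sgnK₂ S j) F (n.2 j)
  /-- `U(r)`-weights -/
  K'₁ : ∀ a, IsWeightedHomogeneous (sgnK'₁ S a) F (n'.1 a)
  /-- `U(s)`-weights -/
  K'₂ : ∀ b, IsWeightedHomogeneous (sgnK'₂ S b) F (n'.2 b)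

/-- **The printed scalar normalisation on `K`**: the highest weight of the `K = U(p) × U(q)`-type with polynomial
weight `n` is `n + ((r−s)/2, …, (r−s)/2; (s−r)/2, …, (s−r)/2) + (m₀/2, …, m₀/2)` — the constants of `𝒫` have the
weight of Lemma 7.10 with all strings empty. [cite: Ichino2022ThetaReal, §7.5 Lemma 7.10] -/
def shiftK (n : IWt S.p S.q) : KWt S.p S.q :=
  (fun i => (n.1 i : ℚ) + ((S.r : ℚ) - S.s) / 2 + (S.m₀ : ℚ) / 2,
   fun j => (n.2 j : ℚ) + ((S.s : ℚ) - S.r) / 2 + (S.m₀ : ℚ) / 2)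

/-- **The printed scalar normalisation on `K′`**: `n′ + ((p−q)/2, …; (q−p)/2, …) + (n₀/2, …, n₀/2)`.
[cite: Ichino2022ThetaReal, §7.5 Lemma 7.10] -/
def shiftK' (n' : IWt S.r S.s) : KWt S.r S.s :=
  (fun a => (n'.1 a : ℚ) + ((S.p : ℚ) - S.q) / 2 + (S.n₀ : ℚ) / 2,
   fun b => (n'.2 b : ℚ) + ((S.q : ℚ) - S.p) / 2 + (S.n₀ : ℚ) / 2)

/-! ## 3. The raising operators of `𝔨_ℂ × 𝔨′_ℂ` (upper-triangular Borels) -/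

/-- **Raising operator `E_{i i′}` of `𝔤𝔩_p = Lie(U(p))_ℂ`** on `𝒫` (use with `i < i′`): covariant
`Σ_a z_{a i} ∂_{a i′}` on `V⁺⊗W⁺`, contragredient `−Σ_b z_{b i′} ∂_{b i}` on `V⁻⊗W⁺`.
[cite: Ichino2022ThetaReal, §7.5] -/
def raiseK₁ (i i' : Fin S.p) : Fock S →ₗ[ℂ] Fock S :=
  (∑ a : Fin S.r, mulXPDeriv (zPR S a i) (zPR S a i')) - ∑ b : Fin S.s, mulXPDeriv (zQR S b i') (zQR S b i)

/-- **Raising operator `E_{j j′}` of `𝔤𝔩_q`**: `Σ_b z_{b j} ∂_{b j′} − Σ_a z_{a j′} ∂_{a j}`.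
[cite: Ichino2022ThetaReal, §7.5] -/
def raiseK₂ (j j' : Fin S.q) : Fock S →ₗ[ℂ] Fock S :=
  (∑ b : Fin S.s, mulXPDeriv (zQS S b j) (zQS S b j')) - ∑ a : Fin S.r, mulXPDeriv (zPS S a j') (zPS S a j)

/-- **Raising operator `E_{a a′}` of `𝔤𝔩_r = Lie(U(r))_ℂ`**: `Σ_i z_{a i} ∂_{a′ i} − Σ_j z_{a′ j} ∂_{a j}`.
[cite: Ichino2022ThetaReal, §7.5] -/
def raiseK'₁ (a a' : Fin S.r) : Fock S →ₗ[ℂ] Fock S :=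
  (∑ i : Fin S.p, mulXPDeriv (zPR S a i) (zPR S a' i)) - ∑ j : Fin S.q, mulXPDeriv (zPS S a' j) (zPS S a j)

/-- **Raising operator `E_{b b′}` of `𝔤𝔩_s`**: `Σ_j z_{b j} ∂_{b′ j} − Σ_i z_{b′ i} ∂_{b i}`.
[cite: Ichino2022ThetaReal, §7.5] -/
def raiseK'₂ (b b' : Fin S.s) : Fock S →ₗ[ℂ] Fock S :=
  (∑ j : Fin S.q, mulXPDeriv (zQS S b j) (zQS S b' j)) - ∑ i : Fin S.p, mulXPDeriv (zQR S b' i) (zQR S b i)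

/-- **`F` is a highest-weight vector for `𝔨 × 𝔨′`**: killed by every raising operator of the four factors.
[cite: Ichino2022ThetaReal, §7.5] -/
structure IsHighest (F : Fock S) : Prop where
  /-- killed by `𝔫⁺ ⊂ 𝔤𝔩_p` -/
  K₁ : ∀ i i' : Fin S.p, i < i' → raiseK₁ S i i' F = 0
  /-- killed by `𝔫⁺ ⊂ 𝔤𝔩_q` -/
  K₂ : ∀ j j' : Fin S.q, j < j' → raiseK₂ S j j' F = 0
  /-- killed by `𝔫⁺ ⊂ 𝔤𝔩_r` -/
  K'₁ : ∀ a a' : Fin S.r, a < a' → raiseK'₁ S a a' F = 0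
  /-- killed by `𝔫⁺ ⊂ 𝔤𝔩_s` -/
  K'₂ : ∀ b b' : Fin S.s, b < b' → raiseK'₂ S b b' F = 0

/-! ## 4. Howe's harmonics and the joint harmonics `ℋ` -/

/-- **The `U(p)`-invariant Laplacians** `Δ_{a b} = Σ_i ∂²/∂z_{a i} ∂z_{b i}` (`a` a `V⁺`-, `b` a `V⁻`-index; the
printed family "`Σ_{ℓ=1}^{p′} ∂²/∂w_{j,ℓ} ∂w_{p+k,ℓ}`"). [cite: KonnoKonno2007, §5.1 p. 71] -/
def lapK₁ (a : Fin S.r) (b : Fin S.s) : Fock S →ₗ[ℂ] Fock S :=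
  ∑ i : Fin S.p, pderivLin (zPR S a i) ∘ₗ pderivLin (zQR S b i)

/-- **The `U(q)`-invariant Laplacians** `Σ_j ∂²/∂z_{a j} ∂z_{b j}` ("`Σ_{ℓ=p′+1}^{n′} ∂²/∂w_{j,ℓ} ∂w_{p+k,ℓ}`").
[cite: KonnoKonno2007, §5.1 p. 71] -/
def lapK₂ (a : Fin S.r) (b : Fin S.s) : Fock S →ₗ[ℂ] Fock S :=
  ∑ j : Fin S.q, pderivLin (zPS S a j) ∘ₗ pderivLin (zQS S b j)

/-- **The `U(r)`-invariant Laplacians** `Σ_a ∂²/∂z_{a i} ∂z_{a j}` (`i` a `W⁺`-, `j` a `W⁻`-index;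
"`Σ_{ℓ=1}^{p} ∂²/∂w_{ℓ,j} ∂w_{ℓ,p′+k}`"). [cite: KonnoKonno2007, §5.1 p. 71] -/
def lapK'₁ (i : Fin S.p) (j : Fin S.q) : Fock S →ₗ[ℂ] Fock S :=
  ∑ a : Fin S.r, pderivLin (zPR S a i) ∘ₗ pderivLin (zPS S a j)

/-- **The `U(s)`-invariant Laplacians** `Σ_b ∂²/∂z_{b i} ∂z_{b j}` ("`Σ_{ℓ=p+1}^{n} ∂²/∂w_{ℓ,j} ∂w_{ℓ,p′+k}`").
[cite: KonnoKonno2007, §5.1 p. 71] -/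
def lapK'₂ (i : Fin S.p) (j : Fin S.q) : Fock S →ₗ[ℂ] Fock S :=
  ∑ b : Fin S.s, pderivLin (zQR S b i) ∘ₗ pderivLin (zQS S b j)

/-- **`ℋ(K)`, the `K`-harmonics** (Howe (3.6) with `L = K`, `L′ = M′`): killed by the `K`-invariant Laplacians
`lapK₁`, `lapK₂` (= `𝔪′^{(0,2)}`). [cite: Howe1989, §3 (3.6) p. 541] -/
def harmonicsK : Submodule ℂ (Fock S) :=
  ⨅ a : Fin S.r, ⨅ b : Fin S.s, LinearMap.ker (lapK₁ S a b) ⊓ LinearMap.ker (lapK₂ S a b)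

/-- **`ℋ(K′)`, the `K′`-harmonics**: killed by `lapK'₁`, `lapK'₂`. [cite: Howe1989, §3 (3.6) p. 541] -/
def harmonicsK' : Submodule ℂ (Fock S) :=
  ⨅ i : Fin S.p, ⨅ j : Fin S.q, LinearMap.ker (lapK'₁ S i j) ⊓ LinearMap.ker (lapK'₂ S i j)

/-- **`ℋ = ℋ(K) ∩ ℋ(K′)`, the joint harmonics** ("`J_{V,W,ξ} := ℋ_V(K_W) ∩ ℋ_W(K_V)`").
[cite: Howe1989, Prop 3.4 p. 544] -/
def jointHarmonics : Submodule ℂ (Fock S) := harmonicsK S ⊓ harmonicsK' S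

section Membership

variable {S}

/-- Unfolding `ℋ(K)`. [cite: Howe1989, §3 (3.6) p. 541] -/
theorem mem_harmonicsK_iff {F : Fock S} :
    F ∈ harmonicsK S ↔ ∀ (a : Fin S.r) (b : Fin S.s), lapK₁ S a b F = 0 ∧ lapK₂ S a b F = 0 := by
  simp only [harmonicsK, Submodule.mem_iInf, Submodule.mem_inf, LinearMap.mem_ker]

/-- Unfolding `ℋ(K′)`. [cite: Howe1989, §3 (3.6) p. 541] -/
theorem mem_harmonicsK'_iff {F : Fock S} :
    F ∈ harmonicsK' S ↔ ∀ (i : Fin S.p) (j : Fin S.q), lapK'₁ S i j F = 0 ∧ lapK'₂ S i j F = 0 := by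
  simp only [harmonicsK', Submodule.mem_iInf, Submodule.mem_inf, LinearMap.mem_ker]

/-- Unfolding `ℋ`. [cite: Howe1989, §3 Prop 3.4 p. 544] -/
theorem mem_jointHarmonics_iff {F : Fock S} :
    F ∈ jointHarmonics S ↔ F ∈ harmonicsK S ∧ F ∈ harmonicsK' S :=
  Submodule.mem_inf

/-- Second partial derivatives kill the variables. [folklore] -/
private theorem pderiv_pderiv_X (k k' l : Idx S) : pderiv k (pderiv k' (X l : Fock S)) = 0 := by
  classical
  by_cases h : l = k'
  · subst h
    rw [pderiv_X_self]
    exact (pderiv k).map_one_eq_zero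
  · rw [pderiv_X_of_ne h, map_zero]

/-- Second partial derivatives kill the constants. [folklore] -/
private theorem pderiv_pderiv_C (k k' : Idx S) (c : ℂ) : pderiv k (pderiv k' (C c : Fock S)) = 0 := by
  rw [pderiv_C, map_zero]

/-- **Linear polynomials are joint harmonic** (all the operators have order two). [cite: Howe1989, §3 p. 542] -/
theorem X_mem_jointHarmonics (l : Idx S) : (X l : Fock S) ∈ jointHarmonics S := by
  rw [mem_jointHarmonics_iff, mem_harmonicsK_iff, mem_harmonicsK'_iff]
  refine ⟨fun a b => ⟨?_, ?_⟩, fun i j => ⟨?_, ?_⟩⟩ <;>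
    simp only [lapK₁, lapK₂, lapK'₁, lapK'₂, LinearMap.sum_apply, LinearMap.comp_apply, pderivLin_apply,
      pderiv_pderiv_X, Finset.sum_const_zero]

/-- **"The constants are both `K` and `K′` harmonic."** [cite: Howe1989, Prop 3.4 p. 544] -/
theorem C_mem_jointHarmonics (c : ℂ) : (C c : Fock S) ∈ jointHarmonics S := by
  rw [mem_jointHarmonics_iff, mem_harmonicsK_iff, mem_harmonicsK'_iff]
  refine ⟨fun a b => ⟨?_, ?_⟩, fun i j => ⟨?_, ?_⟩⟩ <;>
    simp only [lapK₁, lapK₂, lapK'₁, lapK'₂, LinearMap.sum_apply, LinearMap.comp_apply, pderivLin_apply,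
      pderiv_pderiv_C, Finset.sum_const_zero]

/-- `1 ∈ ℋ`. [cite: Howe1989, Prop 3.4 p. 544] -/
theorem one_mem_jointHarmonics : (1 : Fock S) ∈ jointHarmonics S := by
  rw [← C_1]; exact C_mem_jointHarmonics 1

end Membership

/-! ## 5. Joint highest-weight vectors, "`μ` and `μ′` correspond", the canonical dictionary, Lemma 7.10 -/

/-- **A joint harmonic highest-weight vector of polynomial weight `(n; n′)`**: non-zero, in `ℋ`, a weight vector of
`𝔨 × 𝔨′` with weights `(n; n′)`, killed by `𝔫⁺ × 𝔫′⁺`. [cite: Ichino2022ThetaReal, §7.5] -/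
structure IsJointHWVector (F : Fock S) (n : IWt S.p S.q) (n' : IWt S.r S.s) : Prop where
  /-- non-zero -/
  ne_zero : F ≠ 0
  /-- joint harmonic -/
  harm : F ∈ jointHarmonics S
  /-- weight vector -/
  wt : IsWeightVector S F n n'
  /-- highest -/
  hw : IsHighest S F

/-- **"`μ` and `μ′` correspond"** — `μ ⊠ μ′` occurs in `ℋ`: for the irreducible representations of `K` and `K′`
with highest weights `μ`, `μ′` (dominant; integral after removing the printed shifts), the `K × K′`-invariant
space `ℋ` contains a joint highest-weight vector of weight `(μ, μ′)`. [cite: Ichino2022ThetaReal, §7.5] -/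
def corresponds (μ : KWt S.p S.q) (μ' : KWt S.r S.s) : Prop :=
  ∃ (F : Fock S) (n : IWt S.p S.q) (n' : IWt S.r S.s),
    IsJointHWVector S F n n' ∧ n.IsDominant ∧ n'.IsDominant ∧ μ = shiftK S n ∧ μ' = shiftK' S n'

/-- **The canonical instance of the §7.5 dictionary**: Ichino's "`μ` and `μ′` correspond" for the Fock model
`𝒫 = ℂ[z_l : l ∈ Idx S]` with its joint harmonics, as DEFINED above. [cite: Ichino2022ThetaReal, §7.5] -/
def fockHarmonics : FockHarmonics S := ⟨corresponds S⟩

/-- Unfolding. [cite: Ichino2022ThetaReal, §7.5] -/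
@[simp] theorem fockHarmonics_corresponds : (fockHarmonics S).corresponds = corresponds S := rfl

/-- **Ichino 2022, Lemma 7.10** (verbatim in `FockHarmonics.Lemma_7_10`): for every datum `S = (p,q;r,s;m₀,n₀)`
of §4.1, two irreducible representations `μ` of `K = U(p) × U(q)` and `μ′` of `K′ = U(r) × U(s)` correspond — `μ ⊠
μ′` occurs in the joint harmonics `ℋ` of the Fock model `𝒫` of `ω_{V,W,χ_V,χ_W,ψ}` — if and only if
`μ = (a₁, …, a_{p⁺}, 0, …, 0, b₁, …, b_{p⁻}; c₁, …, c_{q⁺}, 0, …, 0, d₁, …, d_{q⁻}) + ((r−s)/2, …; (s−r)/2, …) +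
(m₀/2, …, m₀/2)` and `μ′ = (a₁, …, a_{p⁺}, 0, …, 0, d₁, …, d_{q⁻}; c₁, …, c_{q⁺}, 0, …, 0, b₁, …, b_{p⁻}) +
((p−q)/2, …; (q−p)/2, …) + (n₀/2, …, n₀/2)` with `a_i, b_j, c_k, d_l ∈ ℤ`, `a₁ ≥ ⋯ ≥ a_{p⁺} > 0 > b₁ ≥ ⋯ ≥
b_{p⁻}`, `c₁ ≥ ⋯ ≥ c_{q⁺} > 0 > d₁ ≥ ⋯ ≥ d_{q⁻}`, `p⁺ + p⁻ ≤ p`, `q⁺ + q⁻ ≤ q`, `p⁺ + q⁻ ≤ r`, `p⁻ + q⁺ ≤ s` —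
STATED over the definitions of this file (the canonical dictionary `fockHarmonics S`).  Named fact, not proved here
(print: "the assertion follows from [konno]" = [KonnoKonno2007] Thm 5.4; cf. Kashiwara–Vergne 1978, Howe 1989 §3).
[cite: Ichino2022ThetaReal, §7.5 Lemma 7.10] -/
def Ichino2022_Lemma_7_10 : Prop := ∀ S : SplittingDatum, (fockHarmonics S).Lemma_7_10

/-- Unfolding the named fact. [cite: Ichino2022ThetaReal, §7.5 Lemma 7.10] -/
theorem Ichino2022_Lemma_7_10_iff :
    Ichino2022_Lemma_7_10 ↔ ∀ (S : SplittingDatum) (μ : KWt S.p S.q) (μ' : KWt S.r S.s),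
      corresponds S μ μ' ↔ ∃ P : HarmonicParam S, μ = P.mu ∧ μ' = P.mu' :=
  Iff.rfl

/-! ## 6. The `(r,s)`-degree of a `K`-type and minimal degree (the vocabulary of Lemma 7.11) -/

/-- **A `K`-highest-weight vector of polynomial `K`-weight `n`** (no condition on `K′`): non-zero, weight vector for
the `p + q` coordinates of `𝔨`, killed by `𝔫⁺ ⊂ 𝔨_ℂ`. [cite: Ichino2022ThetaReal, §7.5] -/
structure IsKHWVector (F : Fock S) (n : IWt S.p S.q) : Prop where
  /-- non-zero -/
  ne_zero : F ≠ 0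
  /-- `U(p)`-weights -/
  K₁ : ∀ i, IsWeightedHomogeneous (sgnK₁ S i) F (n.1 i)
  /-- `U(q)`-weights -/
  K₂ : ∀ j, IsWeightedHomogeneous (sgnK₂ S j) F (n.2 j)
  /-- killed by `𝔫⁺ ⊂ 𝔤𝔩_p` -/
  hw₁ : ∀ i i' : Fin S.p, i < i' → raiseK₁ S i i' F = 0
  /-- killed by `𝔫⁺ ⊂ 𝔤𝔩_q` -/
  hw₂ : ∀ j j' : Fin S.q, j < j' → raiseK₂ S j j' F = 0

/-- **The `K`-type `μ` occurs in the (`K`-invariant) subspace `U ⊆ 𝒫`**: `U` contains a `K`-highest-weight vector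
whose shifted weight is the dominant `μ`. [cite: Ichino2022ThetaReal, §7.5] -/
def KTypeOccursIn (U : Submodule ℂ (Fock S)) (μ : KWt S.p S.q) : Prop :=
  ∃ (F : Fock S) (n : IWt S.p S.q), F ∈ U ∧ IsKHWVector S F n ∧ n.IsDominant ∧ μ = shiftK S n

/-- **The `(r,s)`-degree of `μ`**: "the smallest nonnegative integer `d` such that the `μ`-isotypic component of
`𝒫_d` is nonzero" (`⊤` if `μ` does not occur in `𝒫`, as in Howe's `deg(σ)` / Adams's `d(σ)`).
[cite: Ichino2022ThetaReal, §7.5] -/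
def kTypeDegree (μ : KWt S.p S.q) : ℕ∞ := ⨅ (d : ℕ) (_ : KTypeOccursIn S (fockDeg S d) μ), (d : ℕ∞)

/-- "`μ` occurs in `ℋ`" (as a `K`-type). [cite: Ichino2022ThetaReal, §7.5] -/
def OccursInHarmonics (μ : KWt S.p S.q) : Prop := KTypeOccursIn S (jointHarmonics S) μ

/-- **"`μ` is of minimal `(r,s)`-degree in `π`"** for a representation `π` of `U(W)` given through the set `T` of
its `K`-types: `μ ∈ T` and its `(r,s)`-degree is minimal among the members of `T`. [cite: Ichino2022ThetaReal, §7.5] -/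
def IsOfMinimalDegreeIn (T : Set (KWt S.p S.q)) (μ : KWt S.p S.q) : Prop :=
  μ ∈ T ∧ ∀ ν ∈ T, kTypeDegree S μ ≤ kTypeDegree S ν

/-- The degree of a `K`-type occurring in `𝒫_d` is at most `d`. [cite: Ichino2022ThetaReal, §7.5] -/
theorem kTypeDegree_le {d : ℕ} {μ : KWt S.p S.q} (h : KTypeOccursIn S (fockDeg S d) μ) :
    kTypeDegree S μ ≤ d :=
  (iInf_le _ d).trans (iInf_le _ h)

/-! ## 7. Sanity of the conventions: the vacuum and the two degree-one boxes realise printed parameters -/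

section Sanity

variable {S}

/-- `z_k ∂_j` kills a different variable. [folklore] -/
private theorem mulXPDeriv_X_of_ne {k j l : Idx S} (h : l ≠ j) : mulXPDeriv k j (X l : Fock S) = 0 := by
  rw [mulXPDeriv_apply, pderiv_X_of_ne h, mul_zero]

/-- `z_k ∂_j 1 = 0`. [folklore] -/
private theorem mulXPDeriv_one (k j : Idx S) : mulXPDeriv k j (1 : Fock S) = 0 := by
  rw [mulXPDeriv_apply, (pderiv j).map_one_eq_zero, mul_zero]

/-- **The constants are a joint highest-weight vector of weight `0`.** [cite: Howe1989, §3 Prop 3.4 p. 544] -/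
theorem isJointHWVector_one (S : SplittingDatum) :
    IsJointHWVector S 1 (fun _ => 0, fun _ => 0) (fun _ => 0, fun _ => 0) where
  ne_zero := one_ne_zero
  harm := one_mem_jointHarmonics
  wt :=
    { K₁ := fun i => isWeightedHomogeneous_one ℂ _
      K₂ := fun j => isWeightedHomogeneous_one ℂ _
      K'₁ := fun a => isWeightedHomogeneous_one ℂ _
      K'₂ := fun b => isWeightedHomogeneous_one ℂ _ }
  hw :=
    { K₁ := fun i i' _ => by
        simp only [raiseK₁, LinearMap.sub_apply, LinearMap.sum_apply, mulXPDeriv_one, Finset.sum_const_zero,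
          sub_zero]
      K₂ := fun j j' _ => by
        simp only [raiseK₂, LinearMap.sub_apply, LinearMap.sum_apply, mulXPDeriv_one, Finset.sum_const_zero,
          sub_zero]
      K'₁ := fun a a' _ => by
        simp only [raiseK'₁, LinearMap.sub_apply, LinearMap.sum_apply, mulXPDeriv_one, Finset.sum_const_zero,
          sub_zero]
      K'₂ := fun b b' _ => by
        simp only [raiseK'₂, LinearMap.sub_apply, LinearMap.sum_apply, mulXPDeriv_one, Finset.sum_const_zero,
          sub_zero] }

/-- **The vacuum pair corresponds, unconditionally**: the constants realise the parameter of Lemma 7.10 with all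
four strings empty (`μ_vac = ((r−s+m₀)/2, …; (s−r+m₀)/2, …)`, `μ′_vac = ((p−q+n₀)/2, …; (q−p+n₀)/2, …)`); compare
`FockHarmonics.vacuum_corresponds`, which derives it from the hypothesis `Lemma_7_10`.
[cite: Ichino2022ThetaReal, §7.5 Lemma 7.10] -/
theorem corresponds_vacuum (S : SplittingDatum) :
    (fockHarmonics S).corresponds (HarmonicParam.vacuum S).mu (HarmonicParam.vacuum S).mu' := by
  refine ⟨1, (fun _ => 0, fun _ => 0), (fun _ => 0, fun _ => 0), isJointHWVector_one S,
    ⟨antitone_const, antitone_const⟩, ⟨antitone_const, antitone_const⟩, ?_, ?_⟩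
  · rw [HarmonicParam.vacuum_mu]
    refine Prod.ext (funext fun i => ?_) (funext fun j => ?_) <;> simp [shiftK]
  · rw [HarmonicParam.vacuum_mu']
    refine Prod.ext (funext fun a => ?_) (funext fun b => ?_) <;> simp [shiftK']

/-- The parameter `p⁺ = 1`, `a = (1)`, all other strings empty (needs `p ≥ 1`, `r ≥ 1`).
[cite: Ichino2022ThetaReal, §7.5 Lemma 7.10] -/
def HarmonicParam.posBox (S : SplittingDatum) (hp : 0 < S.p) (hr : 0 < S.r) : HarmonicParam S where
  pp := 1
  pm := 0
  qp := 0
  qm := 0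
  a := fun _ => 1
  b := Fin.elim0
  c := Fin.elim0
  d := Fin.elim0
  a_anti := fun _ _ _ => le_rfl
  b_anti := fun i => i.elim0
  c_anti := fun i => i.elim0
  d_anti := fun i => i.elim0
  a_pos := fun _ => one_pos
  b_neg := fun i => i.elim0
  c_pos := fun i => i.elim0
  d_neg := fun i => i.elim0
  hp := by omega
  hq := by omega
  hr := by omega
  hs := by omega

/-- The parameter `p⁻ = 1`, `b = (−1)`, all other strings empty (needs `p ≥ 1`, `s ≥ 1`).
[cite: Ichino2022ThetaReal, §7.5 Lemma 7.10] -/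
def HarmonicParam.negBox (S : SplittingDatum) (hp : 0 < S.p) (hs : 0 < S.s) : HarmonicParam S where
  pp := 0
  pm := 1
  qp := 0
  qm := 0
  a := Fin.elim0
  b := fun _ => -1
  c := Fin.elim0
  d := Fin.elim0
  a_anti := fun i => i.elim0
  b_anti := fun _ _ _ => le_rfl
  c_anti := fun i => i.elim0
  d_anti := fun i => i.elim0
  a_pos := fun i => i.elim0
  b_neg := fun _ => by norm_num
  c_pos := fun i => i.elim0
  d_neg := fun i => i.elim0
  hp := by omega
  hq := by omega
  hr := by omega
  hs := by omega

/-- The head block vector `(1, 0, …, 0)` is the indicator of the first index. [cite: Ichino2022ThetaReal, §7.5 Lemma 7.10] -/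
theorem pad_one_head (N : ℕ) (h : 1 + 0 ≤ N) (i : Fin N) :
    pad N 1 0 h (fun _ => (1 : ℤ)) Fin.elim0 i = if i.val = 0 then 1 else 0 := by
  unfold pad
  by_cases hi : i.val = 0
  · simp [hi]
  · have h₁ : ¬ (i.val < 1) := by omega
    simp [h₁, hi]

/-- The tail block vector `(0, …, 0, −1)` is minus the indicator of the last index. [cite: Ichino2022ThetaReal, §7.5 Lemma 7.10] -/
theorem pad_negOne_tail (N : ℕ) (h : 0 + 1 ≤ N) (i : Fin N) :
    pad N 0 1 h Fin.elim0 (fun _ => (-1 : ℤ)) i = if i.val = N - 1 then -1 else 0 := by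
  unfold pad
  by_cases hi : i.val = N - 1
  · simp [hi]
  · have h₂ : ¬ (N - 1 ≤ i.val) := by have := i.isLt; omega
    simp [h₂, hi]

/-- **The positive box corresponds**: for `p, r ≥ 1` the variable `z_{a₁ i₁}` (first `U(r)`- and first
`U(p)`-index, block `V⁺⊗W⁺`) is a joint harmonic highest-weight vector realising the parameter `p⁺ = 1, a = (1)`:
`μ = (1, 0, …, 0; 0, …, 0) + shifts` and `μ′ = (1, 0, …, 0; 0, …, 0) + shifts′` correspond — an instance of the "if"
direction of Lemma 7.10. [cite: Ichino2022ThetaReal, §7.5 Lemma 7.10] -/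
theorem corresponds_posBox (hp : 0 < S.p) (hr : 0 < S.r) :
    (fockHarmonics S).corresponds (HarmonicParam.posBox S hp hr).mu (HarmonicParam.posBox S hp hr).mu' := by
  classical
  -- the vector `z_{a₀ i₀}` with `a₀ = 0 ∈ Fin r`, `i₀ = 0 ∈ Fin p`
  set i₀ : Fin S.p := ⟨0, hp⟩ with hi₀
  set a₀ : Fin S.r := ⟨0, hr⟩ with ha₀
  have hi₀ne : ∀ {i i' : Fin S.p}, i < i' → i₀ ≠ i' := fun {i i'} hii' h => by
    have h1 : i.val < i'.val := hii'
    rw [← h, hi₀] at h1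
    exact absurd h1 (Nat.not_lt_zero _)
  have ha₀ne : ∀ {a a' : Fin S.r}, a < a' → a₀ ≠ a' := fun {a a'} haa' h => by
    have h1 : a.val < a'.val := haa'
    rw [← h, ha₀] at h1
    exact absurd h1 (Nat.not_lt_zero _)
  have hival : ∀ i : Fin S.p, i.val = 0 ↔ i₀ = i := fun i =>
    ⟨fun h => by rw [hi₀]; exact Fin.ext h.symm, fun h => by rw [← h, hi₀]⟩
  have haval : ∀ a : Fin S.r, a.val = 0 ↔ a₀ = a := fun a =>
    ⟨fun h => by rw [ha₀]; exact Fin.ext h.symm, fun h => by rw [← h, ha₀]⟩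
  refine ⟨X (zPR S a₀ i₀), (fun i => sgnK₁ S i (zPR S a₀ i₀), fun j => sgnK₂ S j (zPR S a₀ i₀)),
    (fun a => sgnK'₁ S a (zPR S a₀ i₀), fun b => sgnK'₂ S b (zPR S a₀ i₀)),
    ⟨X_ne_zero _, X_mem_jointHarmonics _,
      ⟨fun i => isWeightedHomogeneous_X ℂ _ _, fun j => isWeightedHomogeneous_X ℂ _ _,
        fun a => isWeightedHomogeneous_X ℂ _ _, fun b => isWeightedHomogeneous_X ℂ _ _⟩, ?_⟩,
    ?_, ?_, ?_, ?_⟩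
  · -- highest: the first indices are never the target index of a covariant raising term
    refine ⟨fun i i' hii' => ?_, fun j j' _ => ?_, fun a a' haa' => ?_, fun b b' _ => ?_⟩
    · have s1 : ∀ a : Fin S.r, mulXPDeriv (zPR S a i) (zPR S a i') (X (zPR S a₀ i₀) : Fock S) = 0 :=
        fun a => mulXPDeriv_X_of_ne (by
          simp only [ne_eq, zPR, Sum.inl.injEq, Prod.mk.injEq, not_and]
          exact fun _ => hi₀ne hii')
      have s2 : ∀ b : Fin S.s, mulXPDeriv (zQR S b i') (zQR S b i) (X (zPR S a₀ i₀) : Fock S) = 0 :=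
        fun b => mulXPDeriv_X_of_ne (by simp [zPR, zQR])
      simp only [raiseK₁, LinearMap.sub_apply, LinearMap.sum_apply, s1, s2, Finset.sum_const_zero, sub_zero]
    · have s1 : ∀ b : Fin S.s, mulXPDeriv (zQS S b j) (zQS S b j') (X (zPR S a₀ i₀) : Fock S) = 0 :=
        fun b => mulXPDeriv_X_of_ne (by simp [zPR, zQS])
      have s2 : ∀ a : Fin S.r, mulXPDeriv (zPS S a j') (zPS S a j) (X (zPR S a₀ i₀) : Fock S) = 0 :=
        fun a => mulXPDeriv_X_of_ne (by simp [zPR, zPS])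
      simp only [raiseK₂, LinearMap.sub_apply, LinearMap.sum_apply, s1, s2, Finset.sum_const_zero, sub_zero]
    · have s1 : ∀ i : Fin S.p, mulXPDeriv (zPR S a i) (zPR S a' i) (X (zPR S a₀ i₀) : Fock S) = 0 :=
        fun i => mulXPDeriv_X_of_ne (by
          simp only [ne_eq, zPR, Sum.inl.injEq, Prod.mk.injEq, not_and]
          exact fun h => absurd h (ha₀ne haa'))
      have s2 : ∀ j : Fin S.q, mulXPDeriv (zPS S a' j) (zPS S a j) (X (zPR S a₀ i₀) : Fock S) = 0 :=
        fun j => mulXPDeriv_X_of_ne (by simp [zPR, zPS])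
      simp only [raiseK'₁, LinearMap.sub_apply, LinearMap.sum_apply, s1, s2, Finset.sum_const_zero, sub_zero]
    · have s1 : ∀ j : Fin S.q, mulXPDeriv (zQS S b j) (zQS S b' j) (X (zPR S a₀ i₀) : Fock S) = 0 :=
        fun j => mulXPDeriv_X_of_ne (by simp [zPR, zQS])
      have s2 : ∀ i : Fin S.p, mulXPDeriv (zQR S b' i) (zQR S b i) (X (zPR S a₀ i₀) : Fock S) = 0 :=
        fun i => mulXPDeriv_X_of_ne (by simp [zPR, zQR])
      simp only [raiseK'₂, LinearMap.sub_apply, LinearMap.sum_apply, s1, s2, Finset.sum_const_zero, sub_zero]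
  · -- dominance of the `K`-weight `(δ_{i i₀}; 0)`, `i₀` first
    refine ⟨fun x y hxy => ?_, fun x y _ => ?_⟩
    · simp only [sgnK₁_zPR]
      by_cases hy : i₀ = y
      · have hx : i₀ = x := by
          have h1 : x.val ≤ y.val := hxy
          have h2 : y.val = 0 := (hival y).mpr hy
          exact (hival x).mp (by omega)
        rw [if_pos hy, if_pos hx]
      · rw [if_neg hy]; split_ifs <;> norm_num
    · simp only [sgnK₂_zPR]; exact le_rfl
  · -- dominance of the `K′`-weight `(δ_{a a₀}; 0)`, `a₀` first
    refine ⟨fun x y hxy => ?_, fun x y _ => ?_⟩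
    · simp only [sgnK'₁_zPR]
      by_cases hy : a₀ = y
      · have hx : a₀ = x := by
          have h1 : x.val ≤ y.val := hxy
          have h2 : y.val = 0 := (haval y).mpr hy
          exact (haval x).mp (by omega)
        rw [if_pos hy, if_pos hx]
      · rw [if_neg hy]; split_ifs <;> norm_num
    · simp only [sgnK'₂_zPR]; exact le_rfl
  · -- `μ = posBox.mu`
    refine Prod.ext (funext fun i => ?_) (funext fun j => ?_)
    · simp only [HarmonicParam.mu, HarmonicParam.posBox, shiftK, sgnK₁_zPR, pad_one_head]
      by_cases h : i.val = 0
      · rw [if_pos h, if_pos ((hival i).mp h)]; push_cast; ring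
      · rw [if_neg h, if_neg (mt (hival i).mpr h)]; push_cast; ring
    · simp only [HarmonicParam.mu, HarmonicParam.posBox, shiftK, sgnK₂_zPR, pad_empty]
      push_cast; ring
  · -- `μ′ = posBox.mu'`
    refine Prod.ext (funext fun a => ?_) (funext fun b => ?_)
    · simp only [HarmonicParam.mu', HarmonicParam.posBox, shiftK', sgnK'₁_zPR, pad_one_head]
      by_cases h : a.val = 0
      · rw [if_pos h, if_pos ((haval a).mp h)]; push_cast; ring
      · rw [if_neg h, if_neg (mt (haval a).mpr h)]; push_cast; ring
    · simp only [HarmonicParam.mu', HarmonicParam.posBox, shiftK', sgnK'₂_zPR, pad_empty]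
      push_cast; ring

/-- **The negative box corresponds**: for `p, s ≥ 1` the variable `z_{b_s i_p}` (LAST `U(s)`- and LAST
`U(p)`-index, mixed block `V⁻⊗W⁺`) is a joint harmonic highest-weight vector realising `p⁻ = 1, b = (−1)`:
`μ = (0, …, 0, −1; 0, …, 0) + shifts`, `μ′ = (0, …, 0; 0, …, 0, −1) + shifts′` correspond — the tails and the sign of
the mixed block, as displayed. [cite: Ichino2022ThetaReal, §7.5 Lemma 7.10] -/
theorem corresponds_negBox (hp : 0 < S.p) (hs : 0 < S.s) :
    (fockHarmonics S).corresponds (HarmonicParam.negBox S hp hs).mu (HarmonicParam.negBox S hp hs).mu' := by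
  classical
  -- the vector `z_{b₀ i₀}` with `b₀ = s − 1 ∈ Fin s`, `i₀ = p − 1 ∈ Fin p`
  set i₀ : Fin S.p := ⟨S.p - 1, by omega⟩ with hi₀
  set b₀ : Fin S.s := ⟨S.s - 1, by omega⟩ with hb₀
  have hi₀ne : ∀ {i i' : Fin S.p}, i < i' → i₀ ≠ i := fun {i i'} hii' h => by
    have h1 : i.val < i'.val := hii'
    have h2 := i'.isLt
    rw [← h, hi₀] at h1
    exact absurd h1 (by dsimp only; omega)
  have hb₀ne : ∀ {b b' : Fin S.s}, b < b' → b₀ ≠ b := fun {b b'} hbb' h => by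
    have h1 : b.val < b'.val := hbb'
    have h2 := b'.isLt
    rw [← h, hb₀] at h1
    exact absurd h1 (by dsimp only; omega)
  have hival : ∀ i : Fin S.p, i.val = S.p - 1 ↔ i₀ = i := fun i =>
    ⟨fun h => by rw [hi₀]; exact Fin.ext h.symm, fun h => by rw [← h, hi₀]⟩
  have hbval : ∀ b : Fin S.s, b.val = S.s - 1 ↔ b₀ = b := fun b =>
    ⟨fun h => by rw [hb₀]; exact Fin.ext h.symm, fun h => by rw [← h, hb₀]⟩
  refine ⟨X (zQR S b₀ i₀), (fun i => sgnK₁ S i (zQR S b₀ i₀), fun j => sgnK₂ S j (zQR S b₀ i₀)),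
    (fun a => sgnK'₁ S a (zQR S b₀ i₀), fun b => sgnK'₂ S b (zQR S b₀ i₀)),
    ⟨X_ne_zero _, X_mem_jointHarmonics _,
      ⟨fun i => isWeightedHomogeneous_X ℂ _ _, fun j => isWeightedHomogeneous_X ℂ _ _,
        fun a => isWeightedHomogeneous_X ℂ _ _, fun b => isWeightedHomogeneous_X ℂ _ _⟩, ?_⟩,
    ?_, ?_, ?_, ?_⟩
  · -- highest: the last indices are never the source index of a contragredient raising term
    refine ⟨fun i i' hii' => ?_, fun j j' _ => ?_, fun a a' _ => ?_, fun b b' hbb' => ?_⟩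
    · have s1 : ∀ a : Fin S.r, mulXPDeriv (zPR S a i) (zPR S a i') (X (zQR S b₀ i₀) : Fock S) = 0 :=
        fun a => mulXPDeriv_X_of_ne (by simp [zPR, zQR])
      have s2 : ∀ b : Fin S.s, mulXPDeriv (zQR S b i') (zQR S b i) (X (zQR S b₀ i₀) : Fock S) = 0 :=
        fun b => mulXPDeriv_X_of_ne (by
          simp only [ne_eq, zQR, Sum.inr.injEq, Prod.mk.injEq, not_and]
          exact fun _ => hi₀ne hii')
      simp only [raiseK₁, LinearMap.sub_apply, LinearMap.sum_apply, s1, s2, Finset.sum_const_zero, sub_zero]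
    · have s1 : ∀ b : Fin S.s, mulXPDeriv (zQS S b j) (zQS S b j') (X (zQR S b₀ i₀) : Fock S) = 0 :=
        fun b => mulXPDeriv_X_of_ne (by simp [zQR, zQS])
      have s2 : ∀ a : Fin S.r, mulXPDeriv (zPS S a j') (zPS S a j) (X (zQR S b₀ i₀) : Fock S) = 0 :=
        fun a => mulXPDeriv_X_of_ne (by simp [zQR, zPS])
      simp only [raiseK₂, LinearMap.sub_apply, LinearMap.sum_apply, s1, s2, Finset.sum_const_zero, sub_zero]
    · have s1 : ∀ i : Fin S.p, mulXPDeriv (zPR S a i) (zPR S a' i) (X (zQR S b₀ i₀) : Fock S) = 0 :=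
        fun i => mulXPDeriv_X_of_ne (by simp [zQR, zPR])
      have s2 : ∀ j : Fin S.q, mulXPDeriv (zPS S a' j) (zPS S a j) (X (zQR S b₀ i₀) : Fock S) = 0 :=
        fun j => mulXPDeriv_X_of_ne (by simp [zQR, zPS])
      simp only [raiseK'₁, LinearMap.sub_apply, LinearMap.sum_apply, s1, s2, Finset.sum_const_zero, sub_zero]
    · have s1 : ∀ j : Fin S.q, mulXPDeriv (zQS S b j) (zQS S b' j) (X (zQR S b₀ i₀) : Fock S) = 0 :=
        fun j => mulXPDeriv_X_of_ne (by simp [zQR, zQS])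
      have s2 : ∀ i : Fin S.p, mulXPDeriv (zQR S b' i) (zQR S b i) (X (zQR S b₀ i₀) : Fock S) = 0 :=
        fun i => mulXPDeriv_X_of_ne (by
          simp only [ne_eq, zQR, Sum.inr.injEq, Prod.mk.injEq, not_and]
          exact fun h => absurd h (hb₀ne hbb'))
      simp only [raiseK'₂, LinearMap.sub_apply, LinearMap.sum_apply, s1, s2, Finset.sum_const_zero, sub_zero]
  · -- dominance of the `K`-weight `(−δ_{i i₀}; 0)`, `i₀` last
    refine ⟨fun x y hxy => ?_, fun x y _ => ?_⟩
    · simp only [sgnK₁_zQR]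
      by_cases hx : i₀ = x
      · have hy : i₀ = y := by
          have h1 : x.val ≤ y.val := hxy
          have h2 : x.val = S.p - 1 := (hival x).mpr hx
          have h3 := y.isLt
          exact (hival y).mp (by omega)
        rw [if_pos hy, if_pos hx]
      · rw [if_neg hx]; split_ifs <;> norm_num
    · simp only [sgnK₂_zQR]; exact le_rfl
  · -- dominance of the `K′`-weight `(0; −δ_{b b₀})`, `b₀` last
    refine ⟨fun x y _ => ?_, fun x y hxy => ?_⟩
    · simp only [sgnK'₁_zQR]; exact le_rfl
    · simp only [sgnK'₂_zQR]
      by_cases hx : b₀ = x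
      · have hy : b₀ = y := by
          have h1 : x.val ≤ y.val := hxy
          have h2 : x.val = S.s - 1 := (hbval x).mpr hx
          have h3 := y.isLt
          exact (hbval y).mp (by omega)
        rw [if_pos hy, if_pos hx]
      · rw [if_neg hx]; split_ifs <;> norm_num
  · -- `μ = negBox.mu`
    refine Prod.ext (funext fun i => ?_) (funext fun j => ?_)
    · simp only [HarmonicParam.mu, HarmonicParam.negBox, shiftK, sgnK₁_zQR, pad_negOne_tail]
      by_cases h : i.val = S.p - 1
      · rw [if_pos h, if_pos ((hival i).mp h)]; push_cast; ring
      · rw [if_neg h, if_neg (mt (hival i).mpr h)]; push_cast; ring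
    · simp only [HarmonicParam.mu, HarmonicParam.negBox, shiftK, sgnK₂_zQR, pad_empty]
      push_cast; ring
  · -- `μ′ = negBox.mu'`
    refine Prod.ext (funext fun a => ?_) (funext fun b => ?_)
    · simp only [HarmonicParam.mu', HarmonicParam.negBox, shiftK', sgnK'₁_zQR, pad_empty]
      push_cast; ring
    · simp only [HarmonicParam.mu', HarmonicParam.negBox, shiftK', sgnK'₂_zQR, pad_negOne_tail]
      by_cases h : b.val = S.s - 1
      · rw [if_pos h, if_pos ((hbval b).mp h)]; push_cast; ring
      · rw [if_neg h, if_neg (mt (hbval b).mpr h)]; push_cast; ring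

end Sanity

end Literature.RepresentationTheory.Ichino2022

end
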